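import Literature.MathematicalPhysics.QuantumFieldTheory.Balaban1983to89.B9Cor36CubeSandwichQ

/-!
# `Balaban1983to89.B9Eq357CubeQpDiffMajorant` — THE (3.57) PERTURBATION LETTERS `F′₂ = Q′_□(Ṽ) − Q′_□(1)`, `F′₂* = Q′_□*(Ṽ) − Q′_□*(1)` OF THE CUBE SEQUENCE IN REAL
# COORDINATES: BLOCK-LOCAL TWO-SPACE MAJORANTS `M₂Σ‖b‖·τ·𝟙[a = a′]` FROM r05's POINTWISE (3.59) SIZES — the binders `hFc`∕`hFcs` of r06's
# `B9Thm34InvBlk.thm34_Cinv_uniform_blk` at the cube (sub-row G-B9-LETTERS, module M5.2-E, FILE E2-4c; design (β) of `lit-balaban-p21/M52E-DESIGN-p21.md`)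

T. Bałaban, *Propagators for lattice gauge theories in a background field*, Commun. Math. Phys. **99** (1985) 389–434
[`Balaban1985BackgroundPropagators`, "B9"]; [4] = T. Bałaban, *Propagators and renormalization transformations for lattice gauge
theories. II*, Commun. Math. Phys. **96** (1984) 223–250 [`Balaban1984PropagatorsII`].

statement-level skeleton of published theorems with citation tags; proofs where landed; nothing here is a claim about the
Yang–Mills mass gap

THE PRINTED LOCUS (verbatim, held `paper:balaban1985-cmp99-background-propagators`, journal page = PDF page + 388).  (3.57) p. 401: *«Q′(U′U) = Q′(U) + F′₂(U′, U),
Q′\*(U′U) = Q′\*(U) + F′₂\*(U′, U)»*; (3.59) p. 402 (the sizes `|F′₂λ| ≦ O(1)α₁Q̃′|λ|`); p. 403 (*«an inverse of the left-hand side can be expressed by a Neumann series convergent for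
α₁ sufficiently small»*); Cor. 3.5 p. 407 (`U = 1`), Cor. 3.6 p. 408 and p. 409 l. 2–5 (the letters of the cube sequence); [4] (2.51)–(2.52) p. 232.

WHY THIS FILE.  r06's C-clause `thm34_Cinv_uniform_blk` takes the (3.57) perturbations as block-local two-space majorants `hFc : HasMajorantHom (fun p => blk p.1) blkP Fc
(cF·α₁·𝟙)`, `hFcs : HasMajorantHom blkP (fun p => blk p.1) Fcs (cF·α₁·𝟙)` with `Qc′ = Qc + Fc`, `Qcs′ = Qcs + Fcs`.  At the cube sequence (`g := geoCK i □`, `blk := blkCubeY i □`,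
`P := BlkCubeY i □ × ι`, `blkP := Prod.fst`; FILES E2-4a∕b) the letters are `Fc := conjHom b ((Q′_□(Ṽ) − Q′_□(1))|_ℝ)`, `Fcs := conjHom b ((Q′_□\*(Ṽ) − Q′_□\*(1))|_ℝ)`, and r05's
`B9Eq357CubeLetters.norm_QpCubeY_sub_one_apply_le ∕ norm_QpsCubeY_sub_one_apply_le` give the POINTWISE (3.59) sizes `‖(Q′_□(Ṽ) − Q′_□(1))λ(s)‖ ≦ τ·Σ_z|q′(s,z)|‖λ(z)‖`,
`‖(Q′_□\*(Ṽ) − Q′_□\*(1))ν(z)‖ ≦ τ·Σ_s|q′\*(z,s)|‖ν(s)‖` (`τ = 2D_aρ`, uniform in the block under (3.37)).  THIS FILE converts such pointwise sizes (taken as hypotheses `hF`,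
`hFs` with an abstract constant `τ ≧ 0`) into the two binders, with `c_F·α₁ := M₂Σ_j‖b_j‖·τ`:
* ★ `hasMajorantHom_conjHom_QpCubeY_sub`, ★ `hasMajorantHom_conjHom_QpsCubeY_sub`; bookkeeping `Qc′ = Qc + Fc` (`conjHom_restrictScalars_eq_add`).

HONEST SCOPE.  Bookkeeping of [4] (2.51)-majorants; the (3.59) sizes are HYPOTHESES (r05's lemmas discharge them at `parSymY` for unitary-like `Ṽ` with `‖Ṽ − 1‖ ≦ ρ` blockwise
— the (3.37) arithmetic `2D_aρ ≦ O(1)α₁` is the assembler's).  Count-neutral; no summit ∕ sub-problem statement is proved; nothing continuum ∕ OS ∕ mass-gap ∕ Clay.  No `sorry`, no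
`axiom`, no `… : Prop` fact, no `instance`, no `notation`, no `def`.  NEW file; nothing landed is modified.  Cell `lit-balaban`, seat `lit-balaban-p21` gen 34, 2026-08-28;
`--supports stmt-QuantumFields-19200` as helper.  Net new unproved facts: 0.

RELATED IN THE TREE, NOT DUPLICATED (searched 2026-08-28): p21 `B9Cor36CubeSandwichQ` (the unperturbed binders `hQc`∕`hQcs`, `sum_abs_qpKc_le_one`; same mechanism); r05
`B9Eq357CubeLetters` (the pointwise (3.59) sizes, by name in the docstrings only — not imported beyond E2-4a's use); r06 `B9Thm34InvBlk` (consumer); pv08 `B6RandomWalkHom`; T9∕p21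
`B9Eq352DivFormLetters`, `B9Eq376POneLetters` — no existing module modified.
-/

noncomputable section

namespace Literature.MathematicalPhysics.QuantumFieldTheory.Balaban1983to89.B9Eq357CubeQpDiffMajorant

open B6KLevelCensusIndexV1 (KIdx)
open B6Cover236MultiLevelBlocks (cubes)
open B6RandomWalk (HasMajorant BlockSupp)
open B6RandomWalkHom (HasMajorantHom)
open B9Thm34Ext (toB6)
open B9Eq39Adjoint (R R_zero)
open B9Eq352DivFormLetters (coordEquiv conj coordEquiv_apply coordEquiv_symm_apply norm_coordSymm_apply_le)
open B9Eq376POneLetters (conjHom conjHom_apply)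
open B6Geom246MultiLevelBoxL0 (blkOf)
open B9CubeLettersOpsL0 (cubeFamY)
open B9CubeLettersBondOpsL0 (BlkCubeY qpKc qpsKc QpCubeY QpsCubeY)
open B9Eq360DeltaPrimeACubeY (blkCubeY blkCubeY_apply)
open B9CubeGeometryInputs (geoCK)
open B9Eq357CubeLetters (qpKc_of_blkOf_ne qpsKc_of_blkOf_eq qpsKc_of_blkOf_ne)
open B9Cor36CubeSandwichQ (sum_abs_qpKc_le_one)
open Node00 (SiteY CfgY SiteParY toKT)

variable {d ℓ : ℕ} {hd : 1 ≤ d + 1} {hL : Odd (ℓ + 1) ∧ 1 < ℓ + 1} {b₀ b₁ : ℝ}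
variable {𝔸 : Type} [NormedRing 𝔸] [NormedAlgebra ℂ 𝔸] [CompleteSpace 𝔸]
variable {ι : Type} [Fintype ι]
variable (i : KIdx d ℓ hd hL b₀ b₁) (c : ↥(cubes (toKT i).D.toDomains)) (b : Module.Basis ι ℝ 𝔸)
variable {Rr : ℝ} {Hp : Prop} (parS : SiteParY 𝔸 i) (V U : CfgY 𝔸 i)

omit [CompleteSpace 𝔸] in
/-- the real-coordinate form of a difference of letters: `conjHom b (Q′(Ṽ)|_ℝ) = conjHom b (Q′(U)|_ℝ) + conjHom b ((Q′(Ṽ) − Q′(U))|_ℝ)` — the shape `Qc′ = Qc + Fc` of the clause.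
[cite: Balaban1985BackgroundPropagators, (3.57) p.401, bookkeeping] -/
theorem conjHom_restrictScalars_eq_add {X Y : Type} (L L₀ : (X → 𝔸) →ₗ[ℂ] (Y → 𝔸)) :
    conjHom b (L.restrictScalars ℝ) = conjHom b (L₀.restrictScalars ℝ) + conjHom b ((L - L₀).restrictScalars ℝ) := by
  refine LinearMap.ext fun μ => funext fun p => ?_
  rw [LinearMap.add_apply, Pi.add_apply, conjHom_apply, conjHom_apply, conjHom_apply, LinearMap.restrictScalars_apply, LinearMap.restrictScalars_apply,
    LinearMap.restrictScalars_apply, LinearMap.sub_apply, Pi.sub_apply, map_sub, Finsupp.sub_apply, add_sub_cancel]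

/-- ★ **BINDER `hFc` AT THE CUBE**: a pointwise (3.59) size `‖(Q′_□(Ṽ) − Q′_□(U))λ(s)‖ ≦ τ·Σ_z|q′_□(s,z)|‖λ(z)‖` (`τ ≧ 0`) makes `conjHom b ((Q′_□(Ṽ) − Q′_□(U))|_ℝ)` block-local
with the two-space majorant `𝟙[a = a′]·M₂Σ_j‖b_j‖·τ` from the site carrier to the cube-block carrier.
[cite: Balaban1985BackgroundPropagators, (3.57) p.401, (3.59) p.402, p.409 l.2–5; Balaban1984PropagatorsII, (2.51) p.232] -/
theorem hasMajorantHom_conjHom_QpCubeY_sub {M₂ : ℝ} (hM₂ : 0 ≤ M₂) (hrepr : ∀ (v : 𝔸) (j : ι), |b.repr v j| ≤ M₂ * ‖v‖) {τ : ℝ} (hτ : 0 ≤ τ)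
    (hF : ∀ (s : BlkCubeY i c) (lam : SiteY i → 𝔸),
      ‖(QpCubeY i c parS V lam - QpCubeY i c parS U lam) s‖ ≤ τ * ∑ z, |qpKc i c s z| * ‖lam z‖) :
    HasMajorantHom (g := toB6 (geoCK i c) Rr Hp) (fun p : SiteY i × ι => blkCubeY i c p.1) (fun q : BlkCubeY i c × ι => q.1)
      (conjHom b ((QpCubeY i c parS V - QpCubeY i c parS U).restrictScalars ℝ))
      (fun a a' : BlkCubeY i c => if a = a' then M₂ * (∑ j, ‖b j‖) * τ else 0) := by
  intro y' μ B hμ q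
  rw [conjHom_apply, LinearMap.restrictScalars_apply, LinearMap.sub_apply]
  dsimp only
  have hSb : 0 ≤ ∑ j, ‖b j‖ := Finset.sum_nonneg fun j _ => norm_nonneg _
  set lam := (coordEquiv b).symm μ with hlam
  split_ifs with hq
  · -- the block `q.1` IS the source block: r05's size, the row sum `≤ 1`, the synthesis bound
    have hbd : ∀ z, blkOf (cubeFamY i c).toDomains z = q.1 → ‖lam z‖ ≤ (∑ j, ‖b j‖) * B := fun z hz =>
      norm_coordSymm_apply_le b μ z B fun j => hμ.bound (z, j) (by rw [blkCubeY_apply, hz, hq])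
    have hrow : ∑ z, |qpKc i c q.1 z| * ‖lam z‖ ≤ (∑ j, ‖b j‖) * B := by
      calc ∑ z, |qpKc i c q.1 z| * ‖lam z‖ ≤ ∑ z, |qpKc i c q.1 z| * ((∑ j, ‖b j‖) * B) :=
            Finset.sum_le_sum fun z _ => by
              by_cases hz : blkOf (cubeFamY i c).toDomains z = q.1
              · exact mul_le_mul_of_nonneg_left (hbd z hz) (abs_nonneg _)
              · rw [qpKc_of_blkOf_ne i c hz, abs_zero, zero_mul, zero_mul]
        _ = (∑ z, |qpKc i c q.1 z|) * ((∑ j, ‖b j‖) * B) := by rw [← Finset.sum_mul]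
        _ ≤ 1 * ((∑ j, ‖b j‖) * B) := mul_le_mul_of_nonneg_right (sum_abs_qpKc_le_one i c q.1) (mul_nonneg hSb hμ.nonneg)
        _ = (∑ j, ‖b j‖) * B := one_mul _
    have h1 : ‖(QpCubeY i c parS V lam - QpCubeY i c parS U lam) q.1‖ ≤ τ * ((∑ j, ‖b j‖) * B) :=
      (hF q.1 lam).trans (mul_le_mul_of_nonneg_left hrow hτ)
    calc |b.repr ((QpCubeY i c parS V lam - QpCubeY i c parS U lam) q.1) q.2|
        ≤ M₂ * ‖(QpCubeY i c parS V lam - QpCubeY i c parS U lam) q.1‖ := hrepr _ _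
      _ ≤ M₂ * (τ * ((∑ j, ‖b j‖) * B)) := mul_le_mul_of_nonneg_left h1 hM₂
      _ = M₂ * (∑ j, ‖b j‖) * τ * B := by ring
  · -- a different block: the argument vanishes on `Δ(q.1)`, so does the row
    have hrow : ∑ z, |qpKc i c q.1 z| * ‖lam z‖ = 0 := by
      refine Finset.sum_eq_zero fun z _ => ?_
      by_cases hz : blkOf (cubeFamY i c).toDomains z = q.1
      · have h0 : lam z = 0 := by
          rw [hlam, coordEquiv_symm_apply]
          refine Finset.sum_eq_zero fun j _ => ?_
          rw [hμ.off (z, j) (fun h => hq (by rw [← h, blkCubeY_apply, hz])), zero_smul]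
        rw [h0, norm_zero, mul_zero]
      · rw [qpKc_of_blkOf_ne i c hz, abs_zero, zero_mul]
    have h1 : ‖(QpCubeY i c parS V lam - QpCubeY i c parS U lam) q.1‖ ≤ 0 := by
      have h := hF q.1 lam; rwa [hrow, mul_zero] at h
    have h0 : (QpCubeY i c parS V lam - QpCubeY i c parS U lam) q.1 = 0 := norm_le_zero_iff.1 h1
    rw [h0, map_zero, Finsupp.zero_apply, abs_zero, zero_mul]

/-- ★ **BINDER `hFcs` AT THE CUBE**: a pointwise (3.59) size `‖(Q′_□*(Ṽ) − Q′_□*(U))ν(z)‖ ≦ τ·Σ_s|q′_□*(z,s)|‖ν(s)‖` (`τ ≧ 0`) makes `conjHom b ((Q′_□*(Ṽ) − Q′_□*(U))|_ℝ)`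
block-local with the two-space majorant `𝟙[a = a′]·M₂Σ_j‖b_j‖·τ` from the cube-block carrier to the site carrier.
[cite: Balaban1985BackgroundPropagators, (3.57) p.401, (3.59) p.402, p.409 l.2–5; Balaban1984PropagatorsII, (2.51) p.232] -/
theorem hasMajorantHom_conjHom_QpsCubeY_sub {M₂ : ℝ} (hM₂ : 0 ≤ M₂) (hrepr : ∀ (v : 𝔸) (j : ι), |b.repr v j| ≤ M₂ * ‖v‖) {τ : ℝ} (hτ : 0 ≤ τ)
    (hFs : ∀ (z : SiteY i) (nu : BlkCubeY i c → 𝔸),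
      ‖(QpsCubeY i c parS V nu - QpsCubeY i c parS U nu) z‖ ≤ τ * ∑ s, |qpsKc i c z s| * ‖nu s‖) :
    HasMajorantHom (g := toB6 (geoCK i c) Rr Hp) (fun q : BlkCubeY i c × ι => q.1) (fun p : SiteY i × ι => blkCubeY i c p.1)
      (conjHom b ((QpsCubeY i c parS V - QpsCubeY i c parS U).restrictScalars ℝ))
      (fun a a' : BlkCubeY i c => if a = a' then M₂ * (∑ j, ‖b j‖) * τ else 0) := by
  intro y' μ B hμ p
  rw [conjHom_apply, LinearMap.restrictScalars_apply, LinearMap.sub_apply]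
  dsimp only
  rw [blkCubeY_apply]
  have hSb : 0 ≤ ∑ j, ‖b j‖ := Finset.sum_nonneg fun j _ => norm_nonneg _
  set nu := (coordEquiv b).symm μ with hnu
  -- the column sum `Σ_s |q′*(z,s)|‖ν(s)‖` is the single term at the cube block of `z`
  have hcol : ∑ s, |qpsKc i c p.1 s| * ‖nu s‖ = ‖nu (blkOf (cubeFamY i c).toDomains p.1)‖ := by
    rw [Finset.sum_eq_single (blkOf (cubeFamY i c).toDomains p.1)]
    · rw [qpsKc_of_blkOf_eq i c rfl, abs_one, one_mul]
    · intro s _ hs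
      rw [qpsKc_of_blkOf_ne i c (Ne.symm hs), abs_zero, zero_mul]
    · intro h; exact absurd (Finset.mem_univ _) h
  split_ifs with hp
  · have hbd : ‖nu (blkOf (cubeFamY i c).toDomains p.1)‖ ≤ (∑ j, ‖b j‖) * B :=
      norm_coordSymm_apply_le b μ _ B fun j => hμ.bound (blkOf (cubeFamY i c).toDomains p.1, j) hp
    have h1 : ‖(QpsCubeY i c parS V nu - QpsCubeY i c parS U nu) p.1‖ ≤ τ * ((∑ j, ‖b j‖) * B) := by
      have h := hFs p.1 nu
      rw [hcol] at h
      exact h.trans (mul_le_mul_of_nonneg_left hbd hτ)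
    calc |b.repr ((QpsCubeY i c parS V nu - QpsCubeY i c parS U nu) p.1) p.2|
        ≤ M₂ * ‖(QpsCubeY i c parS V nu - QpsCubeY i c parS U nu) p.1‖ := hrepr _ _
      _ ≤ M₂ * (τ * ((∑ j, ‖b j‖) * B)) := mul_le_mul_of_nonneg_left h1 hM₂
      _ = M₂ * (∑ j, ‖b j‖) * τ * B := by ring
  · have h0' : nu (blkOf (cubeFamY i c).toDomains p.1) = 0 := by
      rw [hnu, coordEquiv_symm_apply]
      exact Finset.sum_eq_zero fun j _ => by rw [hμ.off (blkOf (cubeFamY i c).toDomains p.1, j) hp, zero_smul]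
    have h1 : ‖(QpsCubeY i c parS V nu - QpsCubeY i c parS U nu) p.1‖ ≤ 0 := by
      have h := hFs p.1 nu
      rwa [hcol, h0', norm_zero, mul_zero] at h
    have h0 : (QpsCubeY i c parS V nu - QpsCubeY i c parS U nu) p.1 = 0 := norm_le_zero_iff.1 h1
    rw [h0, map_zero, Finsupp.zero_apply, abs_zero, zero_mul]

end Literature.MathematicalPhysics.QuantumFieldTheory.Balaban1983to89.B9Eq357CubeQpDiffMajorant

end
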